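import Literature.MathematicalPhysics.QuantumFieldTheory.Balaban1983to89.B9SectCDiffAssembly

/-!
# `Balaban1983to89.B9SectCDiffCutModel` — hypothesis (L) of THEOREM D from ONE CUTOFF FUNCTION: the seven zone
fields of `…B9SectCDiffAssembly.LDat` DERIVED from a geometric cut model (item (T1) of the cell brief
`b2b-balaban-r1/g12/BRIEF-gen13.md`, census `b2b-balaban-r1/SectC-inst-census.md` §3/§6(a))

B9 = T. Bałaban, *Propagators for lattice gauge theories in a background field*, Commun. Math. Phys. **99**, 389–434
(1985) [Balaban1985BackgroundPropagators]; [4] = B6 = T. Bałaban, *Propagators and renormalization transformations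
for lattice gauge theories. II*, Commun. Math. Phys. **96**, 223–250 (1984) [Balaban1984PropagatorsII].

CITATION HEADER (lean-in-tree rule 2026-08-18).  Cell `pub-balaban`, unit `b2b-balaban-r1-g13` (READER GROUP A,
lineage r1, gen 13), journal claim `SECTC-DIFF-CUTMODEL`.  Source: doi:10.1007/bf01240355, held
`paper:balaban1985-cmp99-background-propagators`, journal page = PDF page + 388.  Renders READ AS IMAGES by this unit
(`run/shared/lean/pub/pub-balaban/b2b-balaban-ref1/pages/1985-cmp99-background-propagators/…-pNNN-x2.png`):
p. 408 [PDF 20] — *"We take the partition of unity {h_□} defined at the end of Sect. A in [4]. We have Σ_{□∈𝒟} h_□²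
= 1."*; p. 409 [PDF 21] — (3.88), the commutator of `Δ′_a` with `h`, whose averaging part reads *"+ a_j(L^jη)^{−2}
Σ_{x′∈B^j(y)} L^{−jd}(∂h)(Γ^{(j)}_{x,y} ∪ Γ^{(j)}_{y,x′}) R((U(Γ^{(j)}_{y,x})))^{−1}R(U(Γ^{(j)}_{y,x′}))λ(x′) =
h(x)(Δ′_aλ)(x) − (K(h)λ)(x)"*; p. 412 [PDF 24] — *"We have to notice only that the operators may differ outside □̃₀,
and the distance from □̃ to □̃₀ᶜ is at least M (on L^{−j}-scale)."*; p. 413 [PDF 25] — (3.100) *"(D_μhA_ν)(x) =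
h(x)(D_μA_ν)(x) + (∂_μh)(x)R(U(x, x + ηe_μ))A_ν(x + ηe_μ)"*; p. 414 [PDF 26] — *"are first order differential
operators with coefficients determined by derivatives of the function h. They are of the order O(M⁻¹), or O(M⁻²), if
considered on a proper scale."*, (3.102) *"(Q_jhA)(c) = h(c_−)(Q_jA)(c) + Σ_b L^{−jd}Q_j(c, d)(∂h)(Γ_{c_−,b_−})A(b) =
h(c_−)(Q_jA)(c) + (S_j(∂h)A)(c)"* and *"The operator P₁(∂h) satisfies the inequalities (3.49) with the additional small
factor O(M⁻¹) coming from an estimate of the expression (∂h)(Γ_{x,x′}) together with the exponential decay of DPD*"*.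
Tree inputs (by name): `B9SectCDiff.{cutX, tdef}` + its window/far entry lemmas, `B9SectCDiffExpansion.TwoSeq` and
its defects `dQ … dQ't`, `B9SectCDiffEstimate.{BlkMaj, WDec, RowZone, Frame, OpZon}`, `B9SectCDiffDict.{zoneMaj,
zoneMaj_nonneg, zoneMaj_le, wdec_zoneMaj, rowZone_zoneMaj, tdef_rowsum_far, opZon_mono}`,
`B9SectCDiffAssembly.{MOne, MTwo, LDat, core_diff_entry_of_parts, core_dE_entry_of_parts}` (this lineage);
`B6DomainChange.Profile`.  Cell rows: GAPS G-B9-05R residual (iv), this module's row C-r1g13-1, census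
`b2b-balaban-r1/SectC-inst-census.md` §3.  Mathlib otherwise.  No `HarnessLib` fact, no named-fact `Prop`; the new
predicates are HYPOTHESIS structures (`OpLoc`, `CutModel`); no `sorry`.

## WHAT THIS MODULE DOES

Hypothesis (L) of THEOREM D (`…B9SectCDiffEstimate.EstHyp`, bundled as `…B9SectCDiffAssembly.LDat`) asks, for the
seven multiplication-type local defects `𝔇(Q), 𝔇(Q*), 𝔇(∂), 𝔇(∂*), 𝔇(A), 𝔇(Q′), 𝔇(Q′*)` of a two-sequence system
`X : TwoSeq`, membership in the zone classes `𝒵(k, θ)`.  `…B9SectCDiffDict.opZon_of_cut` reduces ONE such field to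
thirteen hypotheses (agreement on the windows, far-vanishing on both sides, flatness of the cutoff across the
support, a mixed-block majorant and its weighted decay, zone location), stated per defect — seven such lists that mix
the cutoff with the operator.  Here the seven fields are derived ONCE from a MODEL-LEVEL description that separates
the two:
* §1 `opZon_of_cut'`: the zone dictionary with agreement required only ON THE CUTOFF SUPPORT
  (`ψ(a) ≠ 0 ∨ χ(v) ≠ 0 ⇒ T₁(a,v) = T₂(a,v)`; where both cutoffs vanish the window entry of `𝔇(T)` is `0` whatever the
  pair does — `tdef_cutX_apply_window_of_agree'`) and with flatness and row sums asked AT ZONE ROWS ONLY (`β = 0` at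
  the row block; elsewhere the majorant `zoneMaj` vanishes).  With the SHARED fine carriers of `TwoSeq` the fine
  cutoffs are diagonal (`cutX id id χ = diagonal χ`, `cutX_id_id`), so window-wide agreement would force `A₁ = A₂`;
  the printed situation is p. 412: the operators *"may differ outside □̃₀"*, at distance `≥ M` from `supp h_□` — and
  for the same reason an h-free record of a sequence-2 operator read through sequence-1 blocks is asked only on the
  zone blocks, where the two sequences coincide.
* §2 THE GEOMETRIC CUT (`OpLoc`, `opZon_of_geom`): all carriers are positioned in one carrier `E` with a distance-like
  function `dE` (no axiom on `dE` is used); the cutoffs of both kinds are the values of ONE function `h : E → ℝ` at the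
  positions (window values at the matched positions); `h` has a PROPER-SCALE MODULUS `|h(e) − h(e′)| ≤
  ω₀·sc(y_e)⁻¹·dE(e,e′)` within a locality radius `ℓ(e)` (the printed `(∂h)(Γ_{c_−,b_−})` of (3.102), `(∂h)(Γ_{x,y} ∪
  Γ_{y,x′})` of (3.88), `(∂_μh)(x)` of (3.100): a difference of `h` along a contour of the operator's range, with
  `sup|∂h| = O(M⁻¹)` on the proper scale), is CONSTANT within radius `ℓ` off the zone blocks (`β(y_e) ≠ 0 ⇒ h` flat at
  `e`) and VANISHES within radius `ℓ` of every non-window coarse element; an operator enters only through an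
  h-FREE locality-and-size record `OpLoc` (range `≤ r·sc^κ` at zone rows and `≤ ℓ` at every row, block row sums
  `≤ c·sc^{k+1−κ}e^{−δ₀ρ}` at zone rows).  `opZon_of_geom`: modulus × range ⇒ flatness `ω₀r·sc^{κ−1}` (`hflat`),
  zone × locality ⇒ `hzone`, row sums ⇒ the mixed-block majorant (`hKT`, `hW`), and `𝔇(T) ∈ 𝒵(k, ω₀·r·c)`.
* §3 `CutModel` = the geometric cut data of a two-sequence system (one `h`, positions, the two coarse windows with
  matched positions, sequence-1 blocks of positions, the three cutoff facts `modulus`/`zone`/`far*`, agreement of the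
  five sequence-dependent pairs on the cutoff support, seven `OpLoc` records and four h-free locality facts for the far
  rows/columns) + the Leibniz block of `LDat` inherited verbatim (the one-sided forms cannot be derived over an
  abstract `TwoSeq` — cell record `SectC-diff-proof.md`); `CutModel.toLDat : LDat … M.theta` with the explicit common
  constant `theta = ω₀·Σ_T r_T c_T + θL`; `core_diff_entry_of_cutModel` / `core_dE_entry_of_cutModel` = THEOREM D's
  conclusion (and its E-twin) from (M) per sequence, (P) and a cut model, on the core `h = 1` of the coarse window.

## WHAT IS NOT CLAIMED (ABSOLUTE RULE)

Nothing printed is asserted.  Every field of `CutModel` is a HYPOTHESIS on a concrete lattice instance (the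
partition of unity `{h_□}` of [4], the block geometry of the two local sequences, the supports and sizes of the
local operators); the module proves only that these structural facts imply the seven zone fields of (L) with an
explicit constant.  The orders `O(M⁻¹)`, `O(M⁻²)` of p. 414 are not derived: they are whatever `ω₀·r_T·c_T` the
instance supplies.  Value = kernel-certified reduction of hypothesis (L) to model-level axioms, NOT summit progress.
-/

namespace Literature.MathematicalPhysics.QuantumFieldTheory.Balaban1983to89.B9SectCDiffCutModel

open Finset Real
open B6DomainChange (Profile)
open B9SectCDiffEstimate
open B9SectCDiffDict
open B9SectCDiffAssembly
open B9SectCDiffExpansion (TwoSeq)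
open B9SectCDiff (tdef cutX)

/-! ## §1 The zone dictionary with agreement ON THE CUTOFF SUPPORT and records AT ZONE ROWS -/

section ZoneDictSupp

variable {S : Type*} {F : Frame S}
variable {u₁ u₂ v₁ v₂ mu mv U₁ U₂ : Type*} [Fintype u₂] [Fintype v₁] [Fintype v₂] [Fintype mu] [Fintype mv]
  [DecidableEq u₁] [DecidableEq u₂] [DecidableEq v₁] [DecidableEq v₂] [DecidableEq U₂]
variable {f₁ : mu → u₁} {f₂ : mu → u₂} {e₁ : mv → v₁} {e₂ : mv → v₂} {ψ : mu → ℝ} {χ : mv → ℝ}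
  {T₁ : Matrix u₁ v₁ ℝ} {T₂ : Matrix u₂ v₂ ℝ} {bu : u₁ → U₁} {bv : v₂ → U₂} {p₁ : U₁ → S} {p₂ : U₂ → S}

omit [Fintype v₂] in
/-- window × window entry under AGREEMENT ON THE CUTOFF SUPPORT: if `T₁(a,v) = T₂(a,v)` whenever `ψ(a) ≠ 0` or
`χ(v) ≠ 0`, then `𝔇(T)(a, v) = (ψ(a) − χ(v))·T₂(a, v)` (where both cutoffs vanish both sides are `0`, whatever the
pair does there — p. 412: the operators *"may differ outside □̃₀"*). [folklore] -/
theorem tdef_cutX_apply_window_of_agree' (hf₁ : Function.Injective f₁) (he₂ : Function.Injective e₂)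
    {a : mu} {v : mv} (hT : (ψ a ≠ 0 ∨ χ v ≠ 0) → T₁ (f₁ a) (e₁ v) = T₂ (f₂ a) (e₂ v)) :
    tdef (cutX f₁ f₂ ψ) (cutX e₁ e₂ χ) T₁ T₂ (f₁ a) (e₂ v) = (ψ a - χ v) * T₂ (f₂ a) (e₂ v) := by
  rw [B9SectCDiff.tdef_cutX_apply_window hf₁ he₂]
  by_cases hc : ψ a ≠ 0 ∨ χ v ≠ 0
  · rw [hT hc]; ring
  · push Not at hc
    rw [hc.1, hc.2]; ring

/-- window row of `𝔇(T)` under agreement on the cutoff support (cf. `…Dict.tdef_rowsum_window`). [folklore] -/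
theorem tdef_rowsum_window' (hf₁ : Function.Injective f₁) (he₂ : Function.Injective e₂)
    (hagree : ∀ a v, (ψ a ≠ 0 ∨ χ v ≠ 0) → T₁ (f₁ a) (e₁ v) = T₂ (f₂ a) (e₂ v))
    (hfarR : ∀ a t, (¬ ∃ v, e₂ v = t) → ψ a * T₂ (f₂ a) t = 0) (a : mu) (J : U₂) :
    ∑ y ∈ univ.filter (fun y => bv y = J), |tdef (cutX f₁ f₂ ψ) (cutX e₁ e₂ χ) T₁ T₂ (f₁ a) y| =
      ∑ v ∈ univ.filter (fun v => bv (e₂ v) = J), |ψ a - χ v| * |T₂ (f₂ a) (e₂ v)| := by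
  classical
  set A := univ.filter (fun y : v₂ => bv y = J) with hA
  set B := univ.filter (fun v : mv => bv (e₂ v) = J) with hB
  have hsub : B.image e₂ ⊆ A := by
    intro y hy
    obtain ⟨v, hv, rfl⟩ := mem_image.1 hy
    exact mem_filter.2 ⟨mem_univ _, (mem_filter.1 hv).2⟩
  have hvan : ∀ y ∈ A, y ∉ B.image e₂ → |tdef (cutX f₁ f₂ ψ) (cutX e₁ e₂ χ) T₁ T₂ (f₁ a) y| = 0 := by
    intro y hy hyB
    have hfar : ¬ ∃ v, e₂ v = y := by
      rintro ⟨v, rfl⟩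
      exact hyB (mem_image.2 ⟨v, mem_filter.2 ⟨mem_univ _, (mem_filter.1 hy).2⟩, rfl⟩)
    rw [B9SectCDiff.tdef_cutX_apply_far_right hf₁ ψ χ T₁ T₂ a hfar, hfarR a y hfar, abs_zero]
  rw [← sum_subset hsub hvan, sum_image fun x _ y _ h => he₂ h]
  refine sum_congr rfl fun v _ => ?_
  rw [tdef_cutX_apply_window_of_agree' hf₁ he₂ (hagree a v), abs_mul]

variable {ϑ : U₁ → ℝ} {KT : Matrix U₁ U₂ ℝ}

/-- `zoneMaj` majorises `𝔇(T)` under agreement on the cutoff support, with the flatness and the mixed-block row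
sums required AT ZONE ROWS ONLY (rows whose block has `β = 0`: a row block carrying an active pair is a zone block by
`hzone`, and the majorant vanishes on every other row block) (cf. `…Dict.blkMaj_zoneMaj`).
[cite: Balaban1985BackgroundPropagators, (3.100) p.413] -/
theorem blkMaj_zoneMaj' (hf₁ : Function.Injective f₁) (he₂ : Function.Injective e₂)
    (hagree : ∀ a v, (ψ a ≠ 0 ∨ χ v ≠ 0) → T₁ (f₁ a) (e₁ v) = T₂ (f₂ a) (e₂ v))
    (hfarR : ∀ a t, (¬ ∃ v, e₂ v = t) → ψ a * T₂ (f₂ a) t = 0)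
    (hfarL : ∀ s v, (¬ ∃ a, f₁ a = s) → T₁ s (e₁ v) * χ v = 0)
    (hflat : ∀ a v, F.β (p₁ (bu (f₁ a))) = 0 → T₂ (f₂ a) (e₂ v) ≠ 0 → |ψ a - χ v| ≤ ϑ (bu (f₁ a)))
    (hϑ : ∀ I, 0 ≤ ϑ I) (hK : ∀ I J, 0 ≤ KT I J)
    (hKT : ∀ a J, F.β (p₁ (bu (f₁ a))) = 0 →
      ∑ v ∈ univ.filter (fun v => bv (e₂ v) = J), |T₂ (f₂ a) (e₂ v)| ≤ KT (bu (f₁ a)) J)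
    (hzone : ∀ a v, T₂ (f₂ a) (e₂ v) ≠ 0 → ψ a ≠ χ v → F.β (p₁ (bu (f₁ a))) = 0) :
    BlkMaj bu bv (tdef (cutX f₁ f₂ ψ) (cutX e₁ e₂ χ) T₁ T₂) (zoneMaj f₁ f₂ e₂ ψ χ T₂ bu ϑ KT) where
  nonneg := zoneMaj_nonneg hϑ hK
  le x J := by
    classical
    by_cases hx : ∃ a, f₁ a = x
    · obtain ⟨a, rfl⟩ := hx
      rw [tdef_rowsum_window' hf₁ he₂ hagree hfarR a J]
      by_cases hc : ∃ a' v, bu (f₁ a') = bu (f₁ a) ∧ T₂ (f₂ a') (e₂ v) ≠ 0 ∧ ψ a' ≠ χ v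
      · have hz : zoneMaj f₁ f₂ e₂ ψ χ T₂ bu ϑ KT (bu (f₁ a)) J = ϑ (bu (f₁ a)) * KT (bu (f₁ a)) J := by
          unfold zoneMaj; rw [if_pos hc]
        obtain ⟨a', v', hb', hT', hne'⟩ := hc
        have hβ : F.β (p₁ (bu (f₁ a))) = 0 := hb' ▸ hzone a' v' hT' hne'
        rw [hz]
        calc ∑ v ∈ univ.filter (fun v => bv (e₂ v) = J), |ψ a - χ v| * |T₂ (f₂ a) (e₂ v)|
            ≤ ∑ v ∈ univ.filter (fun v => bv (e₂ v) = J), ϑ (bu (f₁ a)) * |T₂ (f₂ a) (e₂ v)| :=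
              sum_le_sum fun v _ => by
                by_cases h0 : T₂ (f₂ a) (e₂ v) = 0
                · rw [h0, abs_zero, mul_zero, mul_zero]
                · exact mul_le_mul_of_nonneg_right (hflat a v hβ h0) (abs_nonneg _)
          _ = ϑ (bu (f₁ a)) * ∑ v ∈ univ.filter (fun v => bv (e₂ v) = J), |T₂ (f₂ a) (e₂ v)| := by
              rw [mul_sum]
          _ ≤ ϑ (bu (f₁ a)) * KT (bu (f₁ a)) J := mul_le_mul_of_nonneg_left (hKT a J hβ) (hϑ _)
      · have h0 : ∀ v, |ψ a - χ v| * |T₂ (f₂ a) (e₂ v)| = 0 := by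
          intro v
          by_cases hT : T₂ (f₂ a) (e₂ v) = 0
          · rw [hT, abs_zero, mul_zero]
          · by_cases hψ : ψ a = χ v
            · rw [hψ, sub_self, abs_zero, zero_mul]
            · exact absurd ⟨a, v, rfl, hT, hψ⟩ hc
        rw [sum_eq_zero fun v _ => h0 v]
        exact zoneMaj_nonneg hϑ hK _ _
    · rw [tdef_rowsum_far he₂ hfarL hx J]
      exact zoneMaj_nonneg hϑ hK _ _

/-- **THE ZONE DICTIONARY, agreement on the cutoff support, records at zone rows** (`…Dict.opZon_of_cut` with
`hagree` weakened to `ψ(a) ≠ 0 ∨ χ(v) ≠ 0 ⇒ T₁(a,v) = T₂(a,v)` and `hflat`, `hKT` asked only at rows whose block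
has `β = 0`; the flatness `ϑ` and the mixed-block majorant `K_T` are explicit arguments).  OURS.
[cite: Balaban1985BackgroundPropagators, (3.100) p.413 + p.414] -/
theorem opZon_of_cut' (hF : F.Valid) {k₁ k₂ : ℤ} {θ₀ c : ℝ} (ϑ : U₁ → ℝ) (KT : Matrix U₁ U₂ ℝ)
    (hf₁ : Function.Injective f₁) (he₂ : Function.Injective e₂)
    (hagree : ∀ a v, (ψ a ≠ 0 ∨ χ v ≠ 0) → T₁ (f₁ a) (e₁ v) = T₂ (f₂ a) (e₂ v))
    (hfarR : ∀ a t, (¬ ∃ v, e₂ v = t) → ψ a * T₂ (f₂ a) t = 0)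
    (hfarL : ∀ s v, (¬ ∃ a, f₁ a = s) → T₁ s (e₁ v) * χ v = 0)
    (hflat : ∀ a v, F.β (p₁ (bu (f₁ a))) = 0 → T₂ (f₂ a) (e₂ v) ≠ 0 → |ψ a - χ v| ≤ ϑ (bu (f₁ a)))
    (hϑ : ∀ I, 0 ≤ ϑ I) (hϑle : ∀ I, ϑ I ≤ θ₀ * F.sc (p₁ I) ^ k₁) (hθ₀ : 0 ≤ θ₀) (hK : ∀ I J, 0 ≤ KT I J)
    (hKT : ∀ a J, F.β (p₁ (bu (f₁ a))) = 0 →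
      ∑ v ∈ univ.filter (fun v => bv (e₂ v) = J), |T₂ (f₂ a) (e₂ v)| ≤ KT (bu (f₁ a)) J)
    (hW : WDec F.ρ p₁ p₂ (fun a => F.sc a ^ k₂) c (F.rate 0) KT)
    (hzone : ∀ a v, T₂ (f₂ a) (e₂ v) ≠ 0 → ψ a ≠ χ v → F.β (p₁ (bu (f₁ a))) = 0) :
    OpZon F bu bv p₁ p₂ (k₁ + k₂) (θ₀ * c) (tdef (cutX f₁ f₂ ψ) (cutX e₁ e₂ χ) T₁ T₂) :=
  ⟨zoneMaj f₁ f₂ e₂ ψ χ T₂ bu ϑ KT, blkMaj_zoneMaj' hf₁ he₂ hagree hfarR hfarL hflat hϑ hK hKT hzone,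
    wdec_zoneMaj hF hϑ hϑle hθ₀ hK hW, rowZone_zoneMaj hzone⟩

end ZoneDictSupp

/-! ## §2 The geometric cut: ONE cutoff function on a position carrier, h-free operator records -/

section Geom

/-- cast of the scale power of `𝒵(k, θ)`. [folklore] -/
theorem opZon_castK {S : Type*} {F : Frame S} {u v U V : Type*} [Fintype v] [DecidableEq V] {bu : u → U}
    {bv : v → V} {pU : U → S} {pV : V → S} {k k' : ℤ} {θ : ℝ} {T : Matrix u v ℝ}
    (h : OpZon F bu bv pU pV k θ T) (hk : k = k') : OpZon F bu bv pU pV k' θ T := hk ▸ h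

/-- the diagonal fine cutoff as a `cutX` over the identity window: `cutX id id χ = diagonal χ`. [folklore] -/
theorem cutX_id_id {m : Type*} [Fintype m] [DecidableEq m] (χ : m → ℝ) :
    cutX (id : m → m) id χ = Matrix.diagonal χ := by
  ext s t
  rw [Matrix.diagonal_apply]
  have h := B9SectCDiff.cutX_apply_right (e₁ := (id : m → m)) Function.injective_id χ s t
  simp only [id] at h
  rw [h]
  by_cases hst : s = t
  · subst hst; simp
  · rw [if_neg (Ne.symm hst), if_neg hst]

/-- window column sums are dominated by full block column sums (nonnegative summand). [folklore] -/
theorem sum_window_le {mv v₂ U₂ : Type*} [Fintype mv] [Fintype v₂] [DecidableEq v₂] [DecidableEq U₂]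
    {e₂ : mv → v₂} (he₂ : Function.Injective e₂) {bv : v₂ → U₂} (g : v₂ → ℝ) (hg : ∀ y, 0 ≤ g y) (J : U₂) :
    ∑ v ∈ univ.filter (fun v => bv (e₂ v) = J), g (e₂ v) ≤ ∑ y ∈ univ.filter (fun y => bv y = J), g y := by
  classical
  have hsub : (univ.filter (fun v => bv (e₂ v) = J)).image e₂ ⊆ univ.filter (fun y => bv y = J) := by
    intro y hy
    obtain ⟨v, hv, rfl⟩ := mem_image.1 hy
    exact mem_filter.2 ⟨mem_univ _, (mem_filter.1 hv).2⟩
  have himg : ∑ y ∈ (univ.filter (fun v => bv (e₂ v) = J)).image e₂, g y =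
      ∑ v ∈ univ.filter (fun v => bv (e₂ v) = J), g (e₂ v) := sum_image fun x _ y _ hxy => he₂ hxy
  rw [← himg]
  exact sum_le_sum_of_subset_of_nonneg hsub fun y _ _ => hg y

/-- far-vanishing of the cutoff kills a product: `h ≡ 0` within radius `ℓ(e₀)` of `e₀` and `x ≠ 0 ⇒ e′` within that
radius give `x·h(e′) = 0`. [folklore] -/
theorem mul_h_eq_zero_of_far {E : Type*} {dE : E → E → ℝ} {h ℓ : E → ℝ} {e₀ e' : E} {x : ℝ}
    (hfar : ∀ e', dE e₀ e' ≤ ℓ e₀ → h e' = 0) (hloc : x ≠ 0 → dE e₀ e' ≤ ℓ e₀) : x * h e' = 0 := by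
  by_cases hx : x = 0
  · rw [hx, zero_mul]
  · rw [hfar e' (hloc hx), mul_zero]

/-- [folklore] -/
theorem h_mul_eq_zero_of_far {E : Type*} {dE : E → E → ℝ} {h ℓ : E → ℝ} {e₀ e' : E} {x : ℝ}
    (hfar : ∀ e', dE e₀ e' ≤ ℓ e₀ → h e' = 0) (hloc : x ≠ 0 → dE e₀ e' ≤ ℓ e₀) : h e' * x = 0 := by
  rw [mul_comm]; exact mul_h_eq_zero_of_far hfar hloc

/-- the three constants of an h-free operator record: range constant `r`, range scale power `κ` (range
`≤ r·sc^κ` at the row block: `κ = 1` for block-range operators, `κ = 0`, `r = η` for `∂`), majorant constant `c`.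
OURS (typing). [folklore] -/
structure OpConst where
  /-- range constant -/
  r : ℝ
  /-- range scale power -/
  κ : ℤ
  /-- block row-sum constant -/
  c : ℝ

/-- **h-FREE LOCALITY-AND-SIZE RECORD of one local operator `T`** at the rows `f a` of a window `mu` (row positions
`xr`, column positions `xc`, sequence-1 row blocks `br`, sequence-2 column blocks `bc`), for the target zone class
`k`: RANGE at the row block on the proper scale (`T(a,y) ≠ 0 ⇒ dE(x_a, x_y) ≤ r·sc(y_a)^κ`), LOCALITY within the
cutoff's radius (`≤ ℓ(x_a)`), and block ROW SUMS `Σ_{y ∈ J} |T(a,y)| ≤ c·sc(y_a)^{k+1−κ}·e^{−δ₀ρ(y_a, J)}` (so that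
flatness `ω₀r·sc^{κ−1}` times row sums lands in `𝒵(k, ω₀rc)`).  Range and row sums are asked AT ZONE ROWS ONLY
(`β(y_a) = 0`): the zone blocks lie where the two sequences coincide (p. 412, *"the operators may differ outside
□̃₀"*), so the sequence-1 block scale read at a row of a sequence-2 operator is the common one there; far rows carry
no condition but locality.  The cutoff does not occur.  OURS (typing).
[cite: Balaban1985BackgroundPropagators, (3.102) p.414 + p.412] -/
structure OpLoc {S : Type*} {U₁ U₂ E u v mu : Type*} [Fintype v] [DecidableEq U₂] (F : Frame S) (p₁ : U₁ → S)
    (p₂ : U₂ → S) (dE : E → E → ℝ) (ℓ : E → ℝ) (k : ℤ) (o : OpConst) (T : Matrix u v ℝ) (f : mu → u)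
    (xr : mu → E) (xc : v → E) (br : mu → U₁) (bc : v → U₂) : Prop where
  r_nonneg : 0 ≤ o.r
  c_nonneg : 0 ≤ o.c
  /-- range on the proper scale, at zone rows -/
  rng : ∀ a y, F.β (p₁ (br a)) = 0 → T (f a) y ≠ 0 → dE (xr a) (xc y) ≤ o.r * F.sc (p₁ (br a)) ^ o.κ
  /-- locality within the cutoff's radius, at every row of the window -/
  loc : ∀ a y, T (f a) y ≠ 0 → dE (xr a) (xc y) ≤ ℓ (xr a)
  /-- block row sums with the frame decay, at zone rows -/
  maj : ∀ a J, F.β (p₁ (br a)) = 0 → ∑ y ∈ univ.filter (fun y => bc y = J), |T (f a) y| ≤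
    o.c * F.sc (p₁ (br a)) ^ (k + 1 - o.κ) * Real.exp (-(F.δ₀ * F.ρ (p₁ (br a)) (p₂ J)))

variable {S : Type*} {F : Frame S}
variable {u₁ u₂ v₁ v₂ mu mv U₁ U₂ : Type*} [Fintype u₂] [Fintype v₁] [Fintype v₂] [Fintype mu] [Fintype mv]
  [DecidableEq u₁] [DecidableEq u₂] [DecidableEq v₁] [DecidableEq v₂] [DecidableEq U₂]
variable {f₁ : mu → u₁} {f₂ : mu → u₂} {e₁ : mv → v₁} {e₂ : mv → v₂} {ψ : mu → ℝ} {χ : mv → ℝ}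
  {T₁ : Matrix u₁ v₁ ℝ} {T₂ : Matrix u₂ v₂ ℝ} {bu : u₁ → U₁} {bv : v₂ → U₂} {p₁ : U₁ → S} {p₂ : U₂ → S}
variable {E : Type*} {dE : E → E → ℝ} {h ℓ : E → ℝ} {ω₀ : ℝ} {blk : E → U₁} {xr : mu → E} {xc : v₂ → E}
  {br : mu → U₁} {k : ℤ} {o : OpConst}

/-- **THE GEOMETRIC ZONE DICTIONARY**: for a defect `𝔇(T) = tdef (cutX f₁ f₂ ψ) (cutX e₁ e₂ χ) T₁ T₂` whose
cutoffs are the values of ONE function `h` at the window-row positions `xr` and the column positions `xc ∘ e₂`,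
the PROPER-SCALE MODULUS of `h` within the radius `ℓ` (`|h(e) − h(e′)| ≤ ω₀·sc(y_e)⁻¹·dE(e,e′)` — the printed
`(∂h)(Γ_{c_−,b_−})` of (3.102)), CONSTANCY of `h` within the radius off the zone blocks, and an h-free record
`OpLoc … k o T₂ …` at the window rows give the flatness `|ψ(a) − χ(v)| ≤ ω₀r·sc(y_a)^{κ−1}` on the support at
zone rows, the zone location, and the mixed-block majorant `c·sc^{k+1−κ}e^{−δ₀ρ}` at zone rows; with agreement on the
cutoff support and the two far-vanishing facts, `opZon_of_cut'` gives `𝔇(T) ∈ 𝒵(k, ω₀·r·c)`.  OURS.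
[cite: Balaban1985BackgroundPropagators, (3.102) p.414 + (3.100) p.413] -/
theorem opZon_of_geom (hF : F.Valid) (hf₁ : Function.Injective f₁) (he₂ : Function.Injective e₂)
    (hψ : ∀ a, ψ a = h (xr a)) (hχ : ∀ v, χ v = h (xc (e₂ v))) (hbr : ∀ a, br a = bu (f₁ a))
    (hblk : ∀ a, blk (xr a) = br a)
    (hmod : ∀ e e', dE e e' ≤ ℓ e → |h e - h e'| ≤ ω₀ * (F.sc (p₁ (blk e)))⁻¹ * dE e e') (hω₀ : 0 ≤ ω₀)
    (hzoneE : ∀ e e', dE e e' ≤ ℓ e → h e ≠ h e' → F.β (p₁ (blk e)) = 0)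
    (hop : OpLoc F p₁ p₂ dE ℓ k o T₂ f₂ xr xc br bv)
    (hagree : ∀ a v, (ψ a ≠ 0 ∨ χ v ≠ 0) → T₁ (f₁ a) (e₁ v) = T₂ (f₂ a) (e₂ v))
    (hfarR : ∀ a t, (¬ ∃ v, e₂ v = t) → ψ a * T₂ (f₂ a) t = 0)
    (hfarL : ∀ s v, (¬ ∃ a, f₁ a = s) → T₁ s (e₁ v) * χ v = 0) :
    OpZon F bu bv p₁ p₂ k (ω₀ * o.r * o.c) (tdef (cutX f₁ f₂ ψ) (cutX e₁ e₂ χ) T₁ T₂) := by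
  have hsc : ∀ I, 0 < F.sc (p₁ I) := fun I => hF.hsc _
  -- flatness of the cutoff across the support, read at the row block, from modulus × range
  have hflat : ∀ a v, F.β (p₁ (bu (f₁ a))) = 0 → T₂ (f₂ a) (e₂ v) ≠ 0 →
      |ψ a - χ v| ≤ (fun I => ω₀ * o.r * F.sc (p₁ I) ^ (o.κ - 1)) (bu (f₁ a)) := by
    intro a v hβ hT
    rw [← hbr a] at hβ
    have hd := hop.loc a (e₂ v) hT
    have hr := hop.rng a (e₂ v) hβ hT
    have hm := hmod (xr a) (xc (e₂ v)) hd
    rw [hblk a] at hm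
    rw [hψ a, hχ v, ← hbr a]
    have hinv : 0 ≤ ω₀ * (F.sc (p₁ (br a)))⁻¹ := mul_nonneg hω₀ (inv_nonneg.2 (hsc _).le)
    calc |h (xr a) - h (xc (e₂ v))| ≤ ω₀ * (F.sc (p₁ (br a)))⁻¹ * dE (xr a) (xc (e₂ v)) := hm
      _ ≤ ω₀ * (F.sc (p₁ (br a)))⁻¹ * (o.r * F.sc (p₁ (br a)) ^ o.κ) := mul_le_mul_of_nonneg_left hr hinv
      _ = ω₀ * o.r * (F.sc (p₁ (br a)) ^ o.κ * (F.sc (p₁ (br a)))⁻¹) := by ring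
      _ = ω₀ * o.r * F.sc (p₁ (br a)) ^ (o.κ - 1) := by rw [← zpow_sub_one₀ (hsc _).ne']
  -- the mixed-block majorant from the block row sums
  let KT : Matrix U₁ U₂ ℝ := fun I J =>
    o.c * F.sc (p₁ I) ^ (k + 1 - o.κ) * Real.exp (-(F.rate 0 * F.ρ (p₁ I) (p₂ J)))
  have hKnn : ∀ I J, 0 ≤ KT I J := fun I J =>
    mul_nonneg (mul_nonneg hop.c_nonneg (hF.sc_zpow_nonneg _ _)) (Real.exp_nonneg _)
  have hKT : ∀ a J, F.β (p₁ (bu (f₁ a))) = 0 →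
      ∑ v ∈ univ.filter (fun v => bv (e₂ v) = J), |T₂ (f₂ a) (e₂ v)| ≤ KT (bu (f₁ a)) J := by
    intro a J hβ
    rw [← hbr a] at hβ
    have h1 := sum_window_le he₂ (bv := bv) (fun y => |T₂ (f₂ a) y|) (fun y => abs_nonneg _) J
    have hm := hop.maj a J hβ
    rw [hbr a, ← F.rate_zero] at hm
    exact le_trans h1 hm
  have hW : WDec F.ρ p₁ p₂ (fun a => F.sc a ^ (k + 1 - o.κ)) o.c (F.rate 0) KT := by
    intro I J
    exact le_of_eq (abs_of_nonneg (hKnn I J))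
  -- zone location from constancy off the zone × locality
  have hzone : ∀ a v, T₂ (f₂ a) (e₂ v) ≠ 0 → ψ a ≠ χ v → F.β (p₁ (bu (f₁ a))) = 0 := by
    intro a v hT hne
    rw [hψ a, hχ v] at hne
    rw [← hbr a, ← hblk a]
    exact hzoneE _ _ (hop.loc a (e₂ v) hT) hne
  have hz := opZon_of_cut' hF (k₁ := o.κ - 1) (k₂ := k + 1 - o.κ) (θ₀ := ω₀ * o.r) (c := o.c)
    (fun I => ω₀ * o.r * F.sc (p₁ I) ^ (o.κ - 1)) KT hf₁ he₂ hagree hfarR hfarL hflat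
    (fun I => mul_nonneg (mul_nonneg hω₀ hop.r_nonneg) (hF.sc_zpow_nonneg _ _)) (fun I => le_rfl)
    (mul_nonneg hω₀ hop.r_nonneg) hKnn hKT hW hzone
  exact opZon_castK hz (by ring)

end Geom

/-! ## §3 The cut model of a two-sequence system and `CutModel.toLDat` -/

section Model

universe uu

variable {S : Type*}
variable {s b S₁ S₂ B₁ B₂ : Type uu} [Fintype s] [DecidableEq s] [Fintype b] [DecidableEq b]
  [Fintype S₁] [DecidableEq S₁] [Fintype S₂] [DecidableEq S₂] [Fintype B₁] [DecidableEq B₁] [Fintype B₂]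
  [DecidableEq B₂]
variable {t U₁ U₂ : Type uu} [Fintype t] [DecidableEq U₂]

/-- **THE CUT MODEL of a two-sequence system** (hypothesis structure).  Data: a position carrier `E` with a
distance-like `dE`, THE cutoff function `h : E → ℝ` (`h_□`), a locality radius `ℓ`, the modulus constant `ω₀`
(`sup|∂h|` times the proper scale, printed `O(M⁻¹)`), the sequence-1 block `blk e` of a position, positions of the
six carriers, the two coarse WINDOWS `mS ↪ S_c`, `mB ↪ B_c` with matched positions, seven `OpConst`, and the Leibniz
block of `LDat` (data + classes at a constant `θL`).  Hypotheses: the four cutoffs of `X` are the values of `h`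
(diagonal on the shared fine carriers, `cutX` over the windows); `modulus`, `zone`, `far*` (the three cutoff facts);
agreement of `Q, Q*, A, Q′, Q′*` on the cutoff support; seven h-free `OpLoc` records (sequence-2 member at the window
rows); h-free locality of `Q₁, Q′₁` (far rows) and `Q*₂, Q′*₂` (far columns).  OURS (typing).
[cite: Balaban1985BackgroundPropagators, p.408 + p.412 + (3.100) p.413 + (3.102) p.414] -/
structure CutModel (F : Frame S) (X : TwoSeq s b S₁ S₂ B₁ B₂) (p₁ : U₁ → S) (p₂ : U₂ → S) (bs₁ : s → U₁)
    (bb₁ : b → U₁) (bS₁ : S₁ → U₁) (bB₁ : B₁ → U₁) (bs₂ : s → U₂) (bb₂ : b → U₂) (bt₂ : t → U₂)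
    (bS₂ : S₂ → U₂) (bB₂ : B₂ → U₂) (Dv : Matrix t b ℝ) (E mS mB : Type uu) [Fintype mS] [Fintype mB] where
  /-- distance-like function on positions (no axiom used) -/
  dE : E → E → ℝ
  /-- THE cutoff function -/
  h : E → ℝ
  /-- locality radius at a position -/
  ℓ : E → ℝ
  /-- modulus constant on the proper scale -/
  ω₀ : ℝ
  /-- sequence-1 block of a position -/
  blk : E → U₁
  /-- positions of the six carriers -/
  xs : s → E
  xb : b → E
  xS₁ : S₁ → E
  xS₂ : S₂ → E
  xB₁ : B₁ → E
  xB₂ : B₂ → E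
  /-- the two coarse windows -/
  fS₁ : mS → S₁
  fS₂ : mS → S₂
  fB₁ : mB → B₁
  fB₂ : mB → B₂
  /-- constants of the seven h-free operator records -/
  oQ : OpConst
  oQt : OpConst
  oD : OpConst
  oDt : OpConst
  oA : OpConst
  oQ' : OpConst
  oQ't : OpConst
  /-- the Leibniz block (inherited from `LDat`): constant and coefficient operators -/
  θL : ℝ
  Lm₁ : Matrix b t ℝ
  Lm₀ : Matrix b b ℝ
  Dm₁ : Matrix b t ℝ
  Dm₀ : Matrix b b ℝ
  Am₁ : Matrix s b ℝ
  Am₀ : Matrix s s ℝ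
  hω₀ : 0 ≤ ω₀
  fS₁_inj : Function.Injective fS₁
  fS₂_inj : Function.Injective fS₂
  fB₁_inj : Function.Injective fB₁
  fB₂_inj : Function.Injective fB₂
  /-- matched window positions -/
  xfS : ∀ u, xS₂ (fS₂ u) = xS₁ (fS₁ u)
  xfB : ∀ u, xB₂ (fB₂ u) = xB₁ (fB₁ u)
  /-- blocks of positions = the sequence-1 block maps (fine carriers; coarse windows) -/
  blk_s : ∀ v, blk (xs v) = bs₁ v
  blk_b : ∀ a, blk (xb a) = bb₁ a
  blk_S : ∀ u, blk (xS₁ (fS₁ u)) = bS₁ (fS₁ u)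
  blk_B : ∀ u, blk (xB₁ (fB₁ u)) = bB₁ (fB₁ u)
  /-- the four cutoffs are the values of `h` -/
  hχs : X.χs = Matrix.diagonal fun v => h (xs v)
  hχb : X.χb = Matrix.diagonal fun a => h (xb a)
  hψS : X.ψS = cutX fS₁ fS₂ fun u => h (xS₁ (fS₁ u))
  hψB : X.ψB = cutX fB₁ fB₂ fun u => h (xB₁ (fB₁ u))
  /-- CUTOFF FACT 1: proper-scale modulus within the radius -/
  modulus : ∀ e e', dE e e' ≤ ℓ e → |h e - h e'| ≤ ω₀ * (F.sc (p₁ (blk e)))⁻¹ * dE e e'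
  /-- CUTOFF FACT 2: `h` is constant within the radius off the zone blocks -/
  zone : ∀ e e', dE e e' ≤ ℓ e → h e ≠ h e' → F.β (p₁ (blk e)) = 0
  /-- CUTOFF FACT 3: `h` vanishes within the radius of every non-window coarse element -/
  farS₁ : ∀ I, (¬ ∃ u, fS₁ u = I) → ∀ e', dE (xS₁ I) e' ≤ ℓ (xS₁ I) → h e' = 0
  farS₂ : ∀ J, (¬ ∃ u, fS₂ u = J) → ∀ e', dE (xS₂ J) e' ≤ ℓ (xS₂ J) → h e' = 0
  farB₁ : ∀ I, (¬ ∃ u, fB₁ u = I) → ∀ e', dE (xB₁ I) e' ≤ ℓ (xB₁ I) → h e' = 0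
  farB₂ : ∀ J, (¬ ∃ u, fB₂ u = J) → ∀ e', dE (xB₂ J) e' ≤ ℓ (xB₂ J) → h e' = 0
  /-- agreement of the sequence-dependent pairs ON THE CUTOFF SUPPORT -/
  agQ : ∀ u v, (h (xB₁ (fB₁ u)) ≠ 0 ∨ h (xb v) ≠ 0) → X.Q₁ (fB₁ u) v = X.Q₂ (fB₂ u) v
  agQt : ∀ a u, (h (xb a) ≠ 0 ∨ h (xB₁ (fB₁ u)) ≠ 0) → X.Qt₁ a (fB₁ u) = X.Qt₂ a (fB₂ u)
  agA : ∀ a v, (h (xb a) ≠ 0 ∨ h (xb v) ≠ 0) → X.A₁ a v = X.A₂ a v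
  agQ' : ∀ u v, (h (xS₁ (fS₁ u)) ≠ 0 ∨ h (xs v) ≠ 0) → X.Q'₁ (fS₁ u) v = X.Q'₂ (fS₂ u) v
  agQ't : ∀ a u, (h (xs a) ≠ 0 ∨ h (xS₁ (fS₁ u)) ≠ 0) → X.Q't₁ a (fS₁ u) = X.Q't₂ a (fS₂ u)
  /-- the seven h-free locality-and-size records (sequence-2 member, window rows) -/
  lQ : OpLoc F p₁ p₂ dE ℓ 0 oQ X.Q₂ fB₂ (fun u => xB₂ (fB₂ u)) xb (fun u => bB₁ (fB₁ u)) bb₂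
  lQt : OpLoc F p₁ p₂ dE ℓ 0 oQt X.Qt₂ id xb xB₂ bb₁ bB₂
  lD : OpLoc F p₁ p₂ dE ℓ (-1) oD X.D id xb xs bb₁ bs₂
  lDt : OpLoc F p₁ p₂ dE ℓ (-1) oDt X.Dt id xs xb bs₁ bb₂
  lA : OpLoc F p₁ p₂ dE ℓ (-2) oA X.A₂ id xb xb bb₁ bb₂
  lQ' : OpLoc F p₁ p₂ dE ℓ 0 oQ' X.Q'₂ fS₂ (fun u => xS₂ (fS₂ u)) xs (fun u => bS₁ (fS₁ u)) bs₂
  lQ't : OpLoc F p₁ p₂ dE ℓ 0 oQ't X.Q't₂ id xs xS₂ bs₁ bS₂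
  /-- h-free locality of the sequence-1 members at all rows and of the adjoints at all columns -/
  locQ₁ : ∀ I v, X.Q₁ I v ≠ 0 → dE (xB₁ I) (xb v) ≤ ℓ (xB₁ I)
  locQ'₁ : ∀ I v, X.Q'₁ I v ≠ 0 → dE (xS₁ I) (xs v) ≤ ℓ (xS₁ I)
  locQt₂ : ∀ a J, X.Qt₂ a J ≠ 0 → dE (xB₂ J) (xb a) ≤ ℓ (xB₂ J)
  locQ't₂ : ∀ a J, X.Q't₂ a J ≠ 0 → dE (xS₂ J) (xs a) ≤ ℓ (xS₂ J)
  /-- the Leibniz block: one-sided forms (fields) and coefficient operators in `𝒵(−1, θL)` / `𝒵(−2, θL)` -/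
  hθL : 0 ≤ θL
  hΛ : X.dΛ = Lm₁ * Dv + Lm₀
  zLm₁ : OpZon F bb₁ bt₂ p₁ p₂ (-1) θL Lm₁
  zLm₀ : OpZon F bb₁ bb₂ p₁ p₂ (-2) θL Lm₀
  hM : X.D * X.dDt = Dm₁ * Dv + Dm₀
  zDm₁ : OpZon F bb₁ bt₂ p₁ p₂ (-1) θL Dm₁
  zDm₀ : OpZon F bb₁ bb₂ p₁ p₂ (-2) θL Dm₀
  hA : X.ddA' = Am₁ * X.D + Am₀
  zAm₁ : OpZon F bs₁ bb₂ p₁ p₂ (-1) θL Am₁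
  zAm₀ : OpZon F bs₁ bs₂ p₁ p₂ (-2) θL Am₀

variable {F : Frame S} {X : TwoSeq s b S₁ S₂ B₁ B₂}
variable {p₁ : U₁ → S} {p₂ : U₂ → S} {bs₁ : s → U₁} {bb₁ : b → U₁} {bS₁ : S₁ → U₁} {bB₁ : B₁ → U₁}
  {bs₂ : s → U₂} {bb₂ : b → U₂} {bt₂ : t → U₂} {bS₂ : S₂ → U₂} {bB₂ : B₂ → U₂} {Dv : Matrix t b ℝ}
variable {E mS mB : Type uu} [Fintype mS] [Fintype mB]

namespace CutModel

/-- the sum of the seven products `r_T·c_T`. OURS (typing). [folklore] -/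
noncomputable def psum (M : CutModel F X p₁ p₂ bs₁ bb₁ bS₁ bB₁ bs₂ bb₂ bt₂ bS₂ bB₂ Dv E mS mB) : ℝ :=
  M.oQ.r * M.oQ.c + M.oQt.r * M.oQt.c + M.oD.r * M.oD.c + M.oDt.r * M.oDt.c + M.oA.r * M.oA.c
    + M.oQ'.r * M.oQ'.c + M.oQ't.r * M.oQ't.c

/-- **the common (L) constant** `θ = ω₀·Σ_T r_T c_T + θL`. OURS (typing). [folklore] -/
noncomputable def theta (M : CutModel F X p₁ p₂ bs₁ bb₁ bS₁ bB₁ bs₂ bb₂ bt₂ bS₂ bB₂ Dv E mS mB) : ℝ :=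
  M.ω₀ * M.psum + M.θL

variable (M : CutModel F X p₁ p₂ bs₁ bb₁ bS₁ bB₁ bs₂ bb₂ bt₂ bS₂ bB₂ Dv E mS mB)

/-- [folklore] -/
theorem prods_nonneg : 0 ≤ M.oQ.r * M.oQ.c ∧ 0 ≤ M.oQt.r * M.oQt.c ∧ 0 ≤ M.oD.r * M.oD.c ∧
    0 ≤ M.oDt.r * M.oDt.c ∧ 0 ≤ M.oA.r * M.oA.c ∧ 0 ≤ M.oQ'.r * M.oQ'.c ∧ 0 ≤ M.oQ't.r * M.oQ't.c :=
  ⟨mul_nonneg M.lQ.r_nonneg M.lQ.c_nonneg, mul_nonneg M.lQt.r_nonneg M.lQt.c_nonneg,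
    mul_nonneg M.lD.r_nonneg M.lD.c_nonneg, mul_nonneg M.lDt.r_nonneg M.lDt.c_nonneg,
    mul_nonneg M.lA.r_nonneg M.lA.c_nonneg, mul_nonneg M.lQ'.r_nonneg M.lQ'.c_nonneg,
    mul_nonneg M.lQ't.r_nonneg M.lQ't.c_nonneg⟩

/-- [folklore] -/
theorem psum_nonneg : 0 ≤ M.psum := by
  obtain ⟨h1, h2, h3, h4, h5, h6, h7⟩ := M.prods_nonneg
  unfold psum; linarith

/-- [folklore] -/
theorem theta_nonneg : 0 ≤ M.theta := add_nonneg (mul_nonneg M.hω₀ M.psum_nonneg) M.hθL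

/-- [folklore] -/
theorem θL_le_theta : M.θL ≤ M.theta := le_add_of_nonneg_left (mul_nonneg M.hω₀ M.psum_nonneg)

/-- [folklore] -/
theorem le_theta_of {x : ℝ} (hx : x ≤ M.psum) : M.ω₀ * x ≤ M.theta := by
  have h1 := mul_le_mul_of_nonneg_left hx M.hω₀
  have h2 := M.hθL
  unfold theta; linarith

/-- [folklore] -/
theorem thQ_le : M.ω₀ * M.oQ.r * M.oQ.c ≤ M.theta := by
  obtain ⟨h1, h2, h3, h4, h5, h6, h7⟩ := M.prods_nonneg
  rw [mul_assoc]; exact M.le_theta_of (by unfold psum; linarith)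

/-- [folklore] -/
theorem thQt_le : M.ω₀ * M.oQt.r * M.oQt.c ≤ M.theta := by
  obtain ⟨h1, h2, h3, h4, h5, h6, h7⟩ := M.prods_nonneg
  rw [mul_assoc]; exact M.le_theta_of (by unfold psum; linarith)

/-- [folklore] -/
theorem thD_le : M.ω₀ * M.oD.r * M.oD.c ≤ M.theta := by
  obtain ⟨h1, h2, h3, h4, h5, h6, h7⟩ := M.prods_nonneg
  rw [mul_assoc]; exact M.le_theta_of (by unfold psum; linarith)

/-- [folklore] -/
theorem thDt_le : M.ω₀ * M.oDt.r * M.oDt.c ≤ M.theta := by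
  obtain ⟨h1, h2, h3, h4, h5, h6, h7⟩ := M.prods_nonneg
  rw [mul_assoc]; exact M.le_theta_of (by unfold psum; linarith)

/-- [folklore] -/
theorem thA_le : M.ω₀ * M.oA.r * M.oA.c ≤ M.theta := by
  obtain ⟨h1, h2, h3, h4, h5, h6, h7⟩ := M.prods_nonneg
  rw [mul_assoc]; exact M.le_theta_of (by unfold psum; linarith)

/-- [folklore] -/
theorem thQ'_le : M.ω₀ * M.oQ'.r * M.oQ'.c ≤ M.theta := by
  obtain ⟨h1, h2, h3, h4, h5, h6, h7⟩ := M.prods_nonneg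
  rw [mul_assoc]; exact M.le_theta_of (by unfold psum; linarith)

/-- [folklore] -/
theorem thQ't_le : M.ω₀ * M.oQ't.r * M.oQ't.c ≤ M.theta := by
  obtain ⟨h1, h2, h3, h4, h5, h6, h7⟩ := M.prods_nonneg
  rw [mul_assoc]; exact M.le_theta_of (by unfold psum; linarith)

/-! ### The seven zone fields at their own constants `ω₀·r_T·c_T` -/

/-- `𝔇(Q) ∈ 𝒵(0, ω₀ r_Q c_Q)`: coarse window rows (sequence-1 blocks `bB₁`), diagonal fine cutoff on the shared bonds;
far rows by `farB₁` + `locQ₁`. OURS. [cite: Balaban1985BackgroundPropagators, (3.102) p.414] -/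
theorem zQ_raw (hF : F.Valid) : OpZon F bB₁ bb₂ p₁ p₂ 0 (M.ω₀ * M.oQ.r * M.oQ.c) X.dQ := by
  have hop := M.lQ
  rw [show (fun u => M.xB₂ (M.fB₂ u)) = fun u => M.xB₁ (M.fB₁ u) from funext M.xfB] at hop
  have key := opZon_of_geom (bu := bB₁) (bv := bb₂) (T₁ := X.Q₁) (f₁ := M.fB₁) (e₁ := id) (e₂ := id)
    (ψ := fun u => M.h (M.xB₁ (M.fB₁ u))) (χ := fun v => M.h (M.xb v)) hF M.fB₁_inj
    Function.injective_id (fun _ => rfl) (fun _ => rfl) (fun _ => rfl) M.blk_B M.modulus M.hω₀ M.zone hop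
    M.agQ (fun _ t ht => absurd ⟨t, rfl⟩ ht)
    (fun I v hI => mul_h_eq_zero_of_far (M.farB₁ I hI) (M.locQ₁ I v))
  show OpZon F bB₁ bb₂ p₁ p₂ 0 _ (tdef X.ψB X.χb X.Q₁ X.Q₂)
  rw [M.hψB, M.hχb, ← cutX_id_id]
  exact key

/-- `𝔇(Q*) ∈ 𝒵(0, ω₀ r_{Q*} c_{Q*})`: fine rows (blocks `bb₁`), coarse window columns; far columns by `farB₂` +
`locQt₂`. OURS. [cite: Balaban1985BackgroundPropagators, (3.102)–(3.103) p.414] -/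
theorem zQt_raw (hF : F.Valid) : OpZon F bb₁ bB₂ p₁ p₂ 0 (M.ω₀ * M.oQt.r * M.oQt.c) X.dQt := by
  have key := opZon_of_geom (bu := bb₁) (bv := bB₂) (T₁ := X.Qt₁) (f₁ := id) (e₁ := M.fB₁) (e₂ := M.fB₂)
    (ψ := fun a => M.h (M.xb a)) (χ := fun u => M.h (M.xB₁ (M.fB₁ u))) hF Function.injective_id M.fB₂_inj
    (fun _ => rfl) (fun u => congrArg M.h (M.xfB u).symm) (fun _ => rfl) M.blk_b M.modulus M.hω₀ M.zone
    M.lQt M.agQt (fun a J hJ => h_mul_eq_zero_of_far (M.farB₂ J hJ) (M.locQt₂ a J))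
    (fun _ v hs => absurd ⟨_, rfl⟩ hs)
  show OpZon F bb₁ bB₂ p₁ p₂ 0 _ (tdef X.χb X.ψB X.Qt₁ X.Qt₂)
  rw [M.hχb, M.hψB, ← cutX_id_id]
  exact key

/-- `𝔇(∂) ∈ 𝒵(−1, ω₀ r_∂ c_∂)` (range `η`: `κ = 0`; (3.100)). OURS.
[cite: Balaban1985BackgroundPropagators, (3.100) p.413] -/
theorem zD_raw (hF : F.Valid) : OpZon F bb₁ bs₂ p₁ p₂ (-1) (M.ω₀ * M.oD.r * M.oD.c) X.dD := by
  have key := opZon_of_geom (bu := bb₁) (bv := bs₂) (T₁ := X.D) (f₁ := id) (e₁ := id) (e₂ := id)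
    (ψ := fun a => M.h (M.xb a)) (χ := fun v => M.h (M.xs v)) hF Function.injective_id
    Function.injective_id (fun _ => rfl) (fun _ => rfl) (fun _ => rfl) M.blk_b M.modulus M.hω₀ M.zone M.lD
    (fun _ _ _ => rfl) (fun _ t ht => absurd ⟨t, rfl⟩ ht) (fun _ v hs => absurd ⟨_, rfl⟩ hs)
  show OpZon F bb₁ bs₂ p₁ p₂ (-1) _ (tdef X.χb X.χs X.D X.D)
  rw [M.hχb, M.hχs, ← cutX_id_id, ← cutX_id_id]
  exact key

/-- `𝔇(∂*) ∈ 𝒵(−1, ω₀ r_{∂*} c_{∂*})`. OURS. [cite: Balaban1985BackgroundPropagators, (3.100) p.413] -/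
theorem zDt_raw (hF : F.Valid) : OpZon F bs₁ bb₂ p₁ p₂ (-1) (M.ω₀ * M.oDt.r * M.oDt.c) X.dDt := by
  have key := opZon_of_geom (bu := bs₁) (bv := bb₂) (T₁ := X.Dt) (f₁ := id) (e₁ := id) (e₂ := id)
    (ψ := fun v => M.h (M.xs v)) (χ := fun a => M.h (M.xb a)) hF Function.injective_id
    Function.injective_id (fun _ => rfl) (fun _ => rfl) (fun _ => rfl) M.blk_s M.modulus M.hω₀ M.zone M.lDt
    (fun _ _ _ => rfl) (fun _ t ht => absurd ⟨t, rfl⟩ ht) (fun _ v hs => absurd ⟨_, rfl⟩ hs)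
  show OpZon F bs₁ bb₂ p₁ p₂ (-1) _ (tdef X.χs X.χb X.Dt X.Dt)
  rw [M.hχs, M.hχb, ← cutX_id_id, ← cutX_id_id]
  exact key

/-- `𝔇(A) ∈ 𝒵(−2, ω₀ r_A c_A)` (agreement `A₁ = A₂` only on the cutoff support). OURS.
[cite: Balaban1985BackgroundPropagators, (3.103) p.414] -/
theorem zA_raw (hF : F.Valid) : OpZon F bb₁ bb₂ p₁ p₂ (-2) (M.ω₀ * M.oA.r * M.oA.c) X.dA := by
  have key := opZon_of_geom (bu := bb₁) (bv := bb₂) (T₁ := X.A₁) (f₁ := id) (e₁ := id) (e₂ := id)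
    (ψ := fun a => M.h (M.xb a)) (χ := fun a => M.h (M.xb a)) hF Function.injective_id
    Function.injective_id (fun _ => rfl) (fun _ => rfl) (fun _ => rfl) M.blk_b M.modulus M.hω₀ M.zone M.lA
    M.agA (fun _ t ht => absurd ⟨t, rfl⟩ ht) (fun _ v hs => absurd ⟨_, rfl⟩ hs)
  show OpZon F bb₁ bb₂ p₁ p₂ (-2) _ (tdef X.χb X.χb X.A₁ X.A₂)
  rw [M.hχb, ← cutX_id_id]
  exact key

/-- `𝔇(Q′) ∈ 𝒵(0, ω₀ r_{Q′} c_{Q′})`. OURS. [cite: Balaban1985BackgroundPropagators, (3.102) p.414] -/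
theorem zQ'_raw (hF : F.Valid) : OpZon F bS₁ bs₂ p₁ p₂ 0 (M.ω₀ * M.oQ'.r * M.oQ'.c) X.dQ' := by
  have hop := M.lQ'
  rw [show (fun u => M.xS₂ (M.fS₂ u)) = fun u => M.xS₁ (M.fS₁ u) from funext M.xfS] at hop
  have key := opZon_of_geom (bu := bS₁) (bv := bs₂) (T₁ := X.Q'₁) (f₁ := M.fS₁) (e₁ := id) (e₂ := id)
    (ψ := fun u => M.h (M.xS₁ (M.fS₁ u))) (χ := fun v => M.h (M.xs v)) hF M.fS₁_inj
    Function.injective_id (fun _ => rfl) (fun _ => rfl) (fun _ => rfl) M.blk_S M.modulus M.hω₀ M.zone hop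
    M.agQ' (fun _ t ht => absurd ⟨t, rfl⟩ ht)
    (fun I v hI => mul_h_eq_zero_of_far (M.farS₁ I hI) (M.locQ'₁ I v))
  show OpZon F bS₁ bs₂ p₁ p₂ 0 _ (tdef X.ψS X.χs X.Q'₁ X.Q'₂)
  rw [M.hψS, M.hχs, ← cutX_id_id]
  exact key

/-- `𝔇(Q′*) ∈ 𝒵(0, ω₀ r_{Q′*} c_{Q′*})`. OURS. [cite: Balaban1985BackgroundPropagators, (3.102)–(3.103) p.414] -/
theorem zQ't_raw (hF : F.Valid) :
    OpZon F bs₁ bS₂ p₁ p₂ 0 (M.ω₀ * M.oQ't.r * M.oQ't.c) X.dQ't := by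
  have key := opZon_of_geom (bu := bs₁) (bv := bS₂) (T₁ := X.Q't₁) (f₁ := id) (e₁ := M.fS₁) (e₂ := M.fS₂)
    (ψ := fun a => M.h (M.xs a)) (χ := fun u => M.h (M.xS₁ (M.fS₁ u))) hF Function.injective_id M.fS₂_inj
    (fun _ => rfl) (fun u => congrArg M.h (M.xfS u).symm) (fun _ => rfl) M.blk_s M.modulus M.hω₀ M.zone
    M.lQ't M.agQ't (fun a J hJ => h_mul_eq_zero_of_far (M.farS₂ J hJ) (M.locQ't₂ a J))
    (fun _ v hs => absurd ⟨_, rfl⟩ hs)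
  show OpZon F bs₁ bS₂ p₁ p₂ 0 _ (tdef X.χs X.ψS X.Q't₁ X.Q't₂)
  rw [M.hχs, M.hψS, ← cutX_id_id]
  exact key

/-- **`(L)` FROM THE CUT MODEL**: the bundle `LDat … θ` at the explicit common constant `θ = M.theta =
ω₀·Σ_T r_T c_T + θL` (the seven zone fields by `opZon_of_geom`, lifted by `opZon_mono`; the Leibniz block
inherited).  OURS. [cite: Balaban1985BackgroundPropagators, (3.100) p.413 + p.414] -/
noncomputable def toLDat (hF : F.Valid) :
    LDat F X p₁ p₂ bs₁ bb₁ bS₁ bB₁ bs₂ bb₂ bt₂ bS₂ bB₂ Dv M.theta where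
  Lm₁ := M.Lm₁
  Lm₀ := M.Lm₀
  Dm₁ := M.Dm₁
  Dm₀ := M.Dm₀
  Am₁ := M.Am₁
  Am₀ := M.Am₀
  zQ := opZon_mono hF (M.zQ_raw hF) (mul_nonneg (mul_nonneg M.hω₀ M.lQ.r_nonneg) M.lQ.c_nonneg) M.thQ_le
  zQt := opZon_mono hF (M.zQt_raw hF) (mul_nonneg (mul_nonneg M.hω₀ M.lQt.r_nonneg) M.lQt.c_nonneg)
    M.thQt_le
  zD := opZon_mono hF (M.zD_raw hF) (mul_nonneg (mul_nonneg M.hω₀ M.lD.r_nonneg) M.lD.c_nonneg) M.thD_le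
  zDt := opZon_mono hF (M.zDt_raw hF) (mul_nonneg (mul_nonneg M.hω₀ M.lDt.r_nonneg) M.lDt.c_nonneg)
    M.thDt_le
  zA := opZon_mono hF (M.zA_raw hF) (mul_nonneg (mul_nonneg M.hω₀ M.lA.r_nonneg) M.lA.c_nonneg) M.thA_le
  zQ' := opZon_mono hF (M.zQ'_raw hF) (mul_nonneg (mul_nonneg M.hω₀ M.lQ'.r_nonneg) M.lQ'.c_nonneg)
    M.thQ'_le
  zQ't := opZon_mono hF (M.zQ't_raw hF) (mul_nonneg (mul_nonneg M.hω₀ M.lQ't.r_nonneg) M.lQ't.c_nonneg)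
    M.thQ't_le
  hΛ := M.hΛ
  zLm₁ := opZon_mono hF M.zLm₁ M.hθL M.θL_le_theta
  zLm₀ := opZon_mono hF M.zLm₀ M.hθL M.θL_le_theta
  hM := M.hM
  zDm₁ := opZon_mono hF M.zDm₁ M.hθL M.θL_le_theta
  zDm₀ := opZon_mono hF M.zDm₀ M.hθL M.θL_le_theta
  hA := M.hA
  zAm₁ := opZon_mono hF M.zAm₁ M.hθL M.θL_le_theta
  zAm₀ := opZon_mono hF M.zAm₀ M.hθL M.θL_le_theta

/-- **THEOREM D's conclusion from (M) per sequence, (P) and a CUT MODEL**: on the core `h = 1` of the coarse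
window `mB` the two minimal propagators `QGQ*` differ by at most `22·θ·(max(1,c₁,c₂)·Λ·K(u))¹⁵·sc²·e^{−σρ−β−β}`
with `θ = M.theta` (`core_diff_entry_of_parts` on `M.toLDat`).  OURS.
[cite: Balaban1985BackgroundPropagators, (3.97) p.412 + p.414] -/
theorem core_diff_entry_of_cutModel [Fintype U₁] [DecidableEq U₁] [Fintype U₂]
    (hF : F.Valid) {c₁ c₂ : ℝ} (m₁ : MOne F X p₁ bs₁ bb₁ bS₁ bB₁ c₁)
    (m₂ : MTwo F X p₂ bs₂ bb₂ bt₂ bS₂ bB₂ Dv c₂) (hc₁ : 0 ≤ c₁) (hc₂ : 0 ≤ c₂) (hP₁ : Profile F.ρ p₁ F.K)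
    (hP₂ : Profile F.ρ p₂ F.K) {a v : mB} (ha : M.h (M.xB₁ (M.fB₁ a)) = 1) (hv : M.h (M.xB₁ (M.fB₁ v)) = 1) :
    |X.T₁ (M.fB₁ a) (M.fB₁ v) - X.T₂ (M.fB₂ a) (M.fB₂ v)| ≤ 22 * M.theta * (max 1 (max c₁ c₂) * F.Λ * F.K F.u) ^ 15 *
      F.sc (p₁ (bB₁ (M.fB₁ a))) ^ (2 : ℤ) * Real.exp (-(F.σ * (F.ρ (p₁ (bB₁ (M.fB₁ a))) (p₂ (bB₂ (M.fB₂ v)))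
        + F.β (p₁ (bB₁ (M.fB₁ a))) + F.β (p₂ (bB₂ (M.fB₂ v)))))) :=
  core_diff_entry_of_parts hF m₁ m₂ (M.toLDat hF) hc₁ hc₂ M.theta_nonneg hP₁ hP₂ M.fB₁_inj M.fB₂_inj M.hψB
    ha hv

/-- **the E-twin from a cut model**: on the core `h = 1` of the window `mS` the coarse operators `E = Q′G′²Q′*` of
(3.97) differ by at most `6·θ·(…)¹⁵·sc⁴·e^{−σρ−β−β}` (`core_dE_entry_of_parts` on `M.toLDat`).  OURS.
[cite: Balaban1985BackgroundPropagators, (3.97) p.412 + p.414] -/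
theorem core_dE_entry_of_cutModel [Fintype U₁] [DecidableEq U₁] [Fintype U₂]
    (hF : F.Valid) {c₁ c₂ : ℝ} (m₁ : MOne F X p₁ bs₁ bb₁ bS₁ bB₁ c₁)
    (m₂ : MTwo F X p₂ bs₂ bb₂ bt₂ bS₂ bB₂ Dv c₂) (hc₁ : 0 ≤ c₁) (hc₂ : 0 ≤ c₂) (hP₁ : Profile F.ρ p₁ F.K)
    (hP₂ : Profile F.ρ p₂ F.K) {a v : mS} (ha : M.h (M.xS₁ (M.fS₁ a)) = 1) (hv : M.h (M.xS₁ (M.fS₁ v)) = 1) :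
    |X.E₁ (M.fS₁ a) (M.fS₁ v) - X.E₂ (M.fS₂ a) (M.fS₂ v)| ≤ 6 * M.theta * (max 1 (max c₁ c₂) * F.Λ * F.K F.u) ^ 15 *
      F.sc (p₁ (bS₁ (M.fS₁ a))) ^ (4 : ℤ) * Real.exp (-(F.σ * (F.ρ (p₁ (bS₁ (M.fS₁ a))) (p₂ (bS₂ (M.fS₂ v)))
        + F.β (p₁ (bS₁ (M.fS₁ a))) + F.β (p₂ (bS₂ (M.fS₂ v)))))) :=
  core_dE_entry_of_parts hF m₁ m₂ (M.toLDat hF) hc₁ hc₂ M.theta_nonneg hP₁ hP₂ M.fS₁_inj M.fS₂_inj M.hψS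
    ha hv

end CutModel

end Model

end Literature.MathematicalPhysics.QuantumFieldTheory.Balaban1983to89.B9SectCDiffCutModel
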